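import Literature.AnabelianGeometry.EtaleTheta.Discharge.Sec3Cor38iOfRatSupport
import Literature.AnabelianGeometry.EtaleTheta.Discharge.Sec3Cor38iWeakOfRatSupport
import HarnessLib

/-!
# [EtTh] Corollary 3.8 (i) — NODE CLOSER in print's shape, binding NEITHER «`Ψ` preserves the base-field-theoretic
# pre-steps» (F-2816) NOR «`Ψ` preserves factorisations» (F-2818): both are DERIVED at the node's standing situation

S. Mochizuki, *The étale theta function and its Frobenioid-theoretic manifestations*, Publ. RIMS **45** (2009)
[EtTh], §3, Corollary 3.8 (i): statement PDF p. 80 (printed p. 306), proof PDF p. 81 l. 13–19 of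
`paper:doi-10-2977-prims-1234361159` [cite: MochizukiEtTh2009, Cor 3.8 (i) p.80]:

> "(i) Suppose further that for `i = 1, 2`, the base category `D_i` of `C_i` is Frobenius-slim. Then `Ψ` preserves
> the base-field-theoretic morphisms."

Proof-only companion (theorems only: no `def`, no `Prop` fact, no instance; abc-iut cell, layer L2, cone node
**`EtTh:Cor3.8(i)`**, kernel id `N_EtTh_Cor3_8_i`; R-C «per-node clause coverage» and plan ruling C-R33 / K4 «RE-CLOSE
(vacuous binder: F-2816, F-2818)»; seat abc-iut-w6-d039, gen 4).  PRECEDENT: abc-iut-w4-d103's `Sec3Thm37iNode` (p455829).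

WHY THIS FILE.  The kernel index conjoins abc-iut-w5-d124's row closers `Cor38Hyp.preservesBaseFieldTheoretic_of_rows` /
`Cor38Hyp.cor38_i_of_rows` (p414329), which take the proof rows C38-L06 (`h6 : … → h.PreservesBsFldPreSteps`, FACT row
F-2816) and C38-L07 (`h7 : h.PreservesFactorisation`, F-2818) as BINDERS; both rows are SCHEMATA whose universal closure over
all tempered-Frobenioid DATA is refuted in the tree (`TwoPrimes`, `DegreeTwist`, `UnitToy` records), so the c312-2 K-census
(CONE-K4-RECLOSE.tsv row 25; CONE-FACT-SURGERY.tsv binder sites h6/h7) files the node under «RE-CLOSE (vacuous binder)».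
Print PROVES both rows on p. 81 (l. 14–15 "Thus, `Ψ` preserves the base-field-theoretic pre-steps"; l. 15–18 "`Ψ` preserves
[cf. [Mzk17], Theorem 3.4, (ii), (iii)] the factorization"), and so does the tree: C38-L06 = abc-iut-w5-d124's transport
`preservesBsFldPreSteps_of_C_rows` (p416298) over the criterion C38-L05, a THEOREM from rational support (abc-iut-w5-d130
`bsFldPreStepLimitCriterion_of_ratSupport` p433386 / abc-iut-L6-t12 `…_weak`); C38-L07 = `preservesFactorisation_of_thm34`
over the PROVED [FrdI] Thm. 3.4 (ii) (`FrdI.Thm34ii_holds`, F-0711) and the binder-free row C38-L01 (abc-iut-f-132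
`standardIsotropicNotGroupLike_treeMonoidVocab`; weak: abc-iut-L2-d2 `…Weak`).  THIS FILE packages that at BOTH monoid
vocabularies of record (canonical `treeMonoidVocab`; WEAK `treeMonoidVocabWeak` = the vocabulary of the models of record)
as theorems whose ONLY binders are print's standing situation for the Def. 3.3 (iii) / 3.6 (i)–(ii) data — none of them a
FACT-LIST assumption row:
* §1/§3 (any category vocabularies; `hF_i` = "[Mzk17], Theorem 5.2 (ii): `C_i` is a Frobenioid"): F-2818 from `hF_i` ALONE
  (`preservesFactorisation_of_isFrobenioid_treeMonoidVocab(Weak)`); F-2816 from `hF_i`, "`D_i` Frobenius-slim" and, per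
  side, the four print-level data clauses `hP34Λ` (Prop. 3.4 (ii) at monoid type `Λ`), `hNZ` (Def. 3.6 (ii)(b): a non-zero
  effective divisor of constants), `hZQ` (Rmk. 3.3.1: primes of `Φ₀(Y)` are `ℤ`- or `ℚ`-primes), `hsat` (Def. 3.6 (i): rational
  support of `Φ ⊆ Φ₀^ℝ|_D`) (`preservesBsFldPreSteps_of_ratSupport`); and THE NODE IN PRINT'S SHAPE
  `preservesBaseFieldTheoretic_of_ratSupport`: "`D₁`, `D₂` Frobenius-slim ⟹ `Ψ` preserves the base-field-theoretic morphisms".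
* §2/§4 (canonical category vocabulary `treeCatVocab`; `hF_i` := abc-iut-L2-t3's `isFrobenioid_of_structural`):
  **`cor38_i_node`** / `cor38_i_node_weak` — the node in print's shape from NAMED CLAUSES ONLY, per side {`hBinj` (Def. 3.3
  (iii): pull-backs of `B₀^Λ` injective), `hFSM` (FSM-morphisms of `D_i` are isomorphisms; Rmk. 3.7.2), `hP : T.Prop34Cnst
  cnst` (typed Prop. 3.4 (ii) structure), `hNZ`, `hZQ`, `hsat`}; `cor38_i_node(_weak)_preservesBsFldPreSteps` /
  `…_preservesFactorisation` — the two K4 rows as THEOREMS there; **`cor38_i_node_of_slot`** — the typed `Cor38_i S h`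
  (abc-iut-L2-t3, p407532) at EVERY HONEST READING SLOT `S` of its free vocabulary parameter (`S D_i → IsFrobeniusSlim D_i`);
  the canonical slot is this lineage's `cor38_i_canonical_of_structural` (p438712) / `cor38_i_weak_of_ratSupport_of_structural`.

NOT CLAIMED / HONEST FRAMING.  The typed `Cor38_i` is NOT unconditional over abstract typed data (∀-closure FALSE:
`Cor38ToyPair.not_forall_cor38_i` p432851, `TwoPrimes.not_forall_cor38_i`; `hNZ`/`hZQ`/`hsat` are independent of the typed
interface: `ToyHNZ` p427694, `Sec3Cor38CriterionToy` p425444); the residual binders are clauses of print's «tempered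
Frobenioid» (Def. 3.3 (iii) / 3.6 (i)–(ii), Rmk. 3.3.1, Prop. 3.4 (ii)) not recorded by the frozen structures, each a THEOREM
at every constructed datum (abc-iut-L2-d2 `TateTowerFrd.cor38_i_temperedFrobenioid`, `cor38_i_ofRankOnePoint` p449948,
`WeakPiNat.cor38_i_genuineTemperedFrobenioid` p445706 — Cor. 3.8 (i) with NO binder beyond `h`; F-2816 / F-2818 at the
models: abc-iut-w6-d053 `cor38Hyp_preservesBsFldPreSteps_ofRankOnePoint`, `cor38Hyp_preservesFactorisation_ofRankOnePoint`).
Refereed pre-IUT material ([EtTh] §3 over [FrdI] §§3–5); bookkeeping over PROVED rows, nothing landed is edited or restated;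
nothing here bears on [IUTchIII] Cor. 3.12; no side taken; typed ≠ proved — PROVED modulo the literal binders displayed.
-/

namespace Literature.AnabelianGeometry.EtaleTheta

open CategoryTheory Opposite Function Literature.AlgebraicGeometry.Frobenioids

universe u₀ v₀ u v w u₁ v₁

namespace Cor38Hyp

/-! ## §1 Canonical monoid vocabulary `treeMonoidVocab`, ANY category vocabularies: the two rows and the node from `hF_i` -/

section TreeMonoidVocab

variable {D₀ : Type u₀} [Category.{v₀} D₀] {D₀' : Type u₀} [Category.{v₀} D₀']
  {T : RealifiedDivisorMonoids (D₀ := D₀) treeMonoidVocab.{w}}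
  {T' : RealifiedDivisorMonoids (D₀ := D₀') treeMonoidVocab.{w}}
  {D : Type u} [Category.{v} D] {D' : Type u} [Category.{v} D']
  {VD : FrdICatStub.{u, v, w} D} {VD' : FrdICatStub.{u, v, w} D'}
  {C₁ : TemperedFrobenioid T D VD} {C₂ : TemperedFrobenioid T' D' VD'} (h : Cor38Hyp C₁ C₂)

/-- **C38-L07 = F-2818 «`Ψ` preserves factorisations» from `hF₁`, `hF₂` ALONE** (p.81 l.15–18), canonical monoid
vocabulary, any category vocabularies: abc-iut-f-034's `preservesFactorisation_of_isFrobenioid` with [FrdI] Thm. 3.4 (ii)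
:= the tree theorem `FrdI.Thm34ii_holds` (F-0711) and row C38-L01 := abc-iut-f-132's binder-free
`standardIsotropicNotGroupLike_treeMonoidVocab`. [cite: MochizukiEtTh2009, Cor 3.8 p.81] -/
theorem preservesFactorisation_of_isFrobenioid_treeMonoidVocab
    (hF₁ : PreFrobenioid.IsFrobenioid C₁.toElem) (hF₂ : PreFrobenioid.IsFrobenioid C₂.toElem) :
    Literature.AnabelianGeometry.EtaleTheta.Cor38Hyp.PreservesFactorisation h :=
  h.preservesFactorisation_of_isFrobenioid FrdI.Thm34ii_holds hF₁ hF₂ h.standardIsotropicNotGroupLike_treeMonoidVocab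

/-- **C38-L06 = F-2816 «`Ψ` preserves the base-field-theoretic pre-steps» for Frobenius-slim `D₁`, `D₂`** (p.81
l.14–15), canonical monoid vocabulary, any category vocabularies, from `hF_i` ([FrdI] Thm. 5.2 (ii)) and, per side, the four
print-level data clauses `hP34Λ` (Prop. 3.4 (ii) at monoid type `Λ`), `hNZ` (Def. 3.6 (ii)(b): a non-zero effective divisor of
constants), `hZQ` (Rmk. 3.3.1: primes of `Φ₀(Y)` are `ℤ`- or `ℚ`-primes), `hsat` (Def. 3.6 (i): rational support of `Φ(W)` in
`Φ₀^ℝ(Y_W)`): abc-iut-f-034's `preservesBsFldPreSteps_of_isFrobeniusSlim_of_criterion` (Thm. 3.4 (ii) := `FrdI.Thm34ii_holds`,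
C38-L01 binder-free) with the criterion C38-L05 at THE perfections := abc-iut-w5-d130's
`bsFldPreStepLimitCriterion_of_ratSupport` (p433386). [cite: MochizukiEtTh2009, Cor 3.8 p.81] -/
theorem preservesBsFldPreSteps_of_ratSupport
    (hF₁ : PreFrobenioid.IsFrobenioid C₁.toElem) (hF₂ : PreFrobenioid.IsFrobenioid C₂.toElem)
    (hP34Λ₁ : ∀ (Y : D₀ᵒᵖ) (b : T.BΛ.obj Y) (r : T.ΦR.obj Y),
      T.divΛ Y b = Algebra.GrothendieckGroup.of r → b ∈ T.FΛ Y)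
    (hNZ₁ : ∀ A : Dᵒᵖ, ∃ u : (T.BΛ.obj (C₁.baseOp A) : Type w) × Algebra.GrothendieckGroup (C₁.Φ.carrier A),
      u ∈ C₁.cnstFn A ∧ ∃ Z : C₁.Φ.carrier A, Z ≠ 1 ∧ u.2 = Algebra.GrothendieckGroup.of Z)
    (hZQ₁ : ∀ (W : D) (𝔭 : Primes (T.Φ₀.obj (C₁.baseOp (op W)))),
      IsZMonoprime ↥𝔭.submonoid ∨ IsQMonoprime ↥𝔭.submonoid)
    (hsat₁ : ∀ (W : D), ∀ x ∈ C₁.Φ.carrier (op W), ∃ (N : ℕ+) (d : T.Φ₀.obj (C₁.baseOp (op W))),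
      x ^ (N : ℕ) = T.toR (C₁.baseOp (op W)) d)
    (hP34Λ₂ : ∀ (Y : D₀'ᵒᵖ) (b : T'.BΛ.obj Y) (r : T'.ΦR.obj Y),
      T'.divΛ Y b = Algebra.GrothendieckGroup.of r → b ∈ T'.FΛ Y)
    (hNZ₂ : ∀ A : D'ᵒᵖ, ∃ u : (T'.BΛ.obj (C₂.baseOp A) : Type w) × Algebra.GrothendieckGroup (C₂.Φ.carrier A),
      u ∈ C₂.cnstFn A ∧ ∃ Z : C₂.Φ.carrier A, Z ≠ 1 ∧ u.2 = Algebra.GrothendieckGroup.of Z)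
    (hZQ₂ : ∀ (W : D') (𝔭 : Primes (T'.Φ₀.obj (C₂.baseOp (op W)))),
      IsZMonoprime ↥𝔭.submonoid ∨ IsQMonoprime ↥𝔭.submonoid)
    (hsat₂ : ∀ (W : D'), ∀ x ∈ C₂.Φ.carrier (op W), ∃ (N : ℕ+) (d : T'.Φ₀.obj (C₂.baseOp (op W))),
      x ^ (N : ℕ) = T'.toR (C₂.baseOp (op W)) d)
    (hs₁ : IsFrobeniusSlim D) (hs₂ : IsFrobeniusSlim D') :
    Literature.AnabelianGeometry.EtaleTheta.Cor38Hyp.PreservesBsFldPreSteps h :=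
  h.preservesBsFldPreSteps_of_isFrobeniusSlim_of_criterion FrdI.Thm34ii_holds hF₁ hF₂
    h.standardIsotropicNotGroupLike_treeMonoidVocab hs₁ hs₂
    (C₁.bsFldPreStepLimitCriterion_of_ratSupport hF₁ hP34Λ₁ hNZ₁ hZQ₁ hsat₁)
    (C₂.bsFldPreStepLimitCriterion_of_ratSupport hF₂ hP34Λ₂ hNZ₂ hZQ₂ hsat₂)

/-- **[EtTh] Cor. 3.8 (i) IN PRINT'S SHAPE** — "`D₁`, `D₂` Frobenius-slim ⟹ `Ψ` preserves the base-field-theoretic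
morphisms" — canonical monoid vocabulary, any category vocabularies; binders = `hF_i` + the four print-level data clauses
per side + the node's own hypotheses `hs_i`: this lineage's `cor38_i_of_ratSupport` (p438712) applied to `hs₁`, `hs₂`.
[cite: MochizukiEtTh2009, Cor 3.8 (i) p.80] -/
theorem preservesBaseFieldTheoretic_of_ratSupport
    (hF₁ : PreFrobenioid.IsFrobenioid C₁.toElem) (hF₂ : PreFrobenioid.IsFrobenioid C₂.toElem)
    (hP34Λ₁ : ∀ (Y : D₀ᵒᵖ) (b : T.BΛ.obj Y) (r : T.ΦR.obj Y),
      T.divΛ Y b = Algebra.GrothendieckGroup.of r → b ∈ T.FΛ Y)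
    (hNZ₁ : ∀ A : Dᵒᵖ, ∃ u : (T.BΛ.obj (C₁.baseOp A) : Type w) × Algebra.GrothendieckGroup (C₁.Φ.carrier A),
      u ∈ C₁.cnstFn A ∧ ∃ Z : C₁.Φ.carrier A, Z ≠ 1 ∧ u.2 = Algebra.GrothendieckGroup.of Z)
    (hZQ₁ : ∀ (W : D) (𝔭 : Primes (T.Φ₀.obj (C₁.baseOp (op W)))),
      IsZMonoprime ↥𝔭.submonoid ∨ IsQMonoprime ↥𝔭.submonoid)
    (hsat₁ : ∀ (W : D), ∀ x ∈ C₁.Φ.carrier (op W), ∃ (N : ℕ+) (d : T.Φ₀.obj (C₁.baseOp (op W))),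
      x ^ (N : ℕ) = T.toR (C₁.baseOp (op W)) d)
    (hP34Λ₂ : ∀ (Y : D₀'ᵒᵖ) (b : T'.BΛ.obj Y) (r : T'.ΦR.obj Y),
      T'.divΛ Y b = Algebra.GrothendieckGroup.of r → b ∈ T'.FΛ Y)
    (hNZ₂ : ∀ A : D'ᵒᵖ, ∃ u : (T'.BΛ.obj (C₂.baseOp A) : Type w) × Algebra.GrothendieckGroup (C₂.Φ.carrier A),
      u ∈ C₂.cnstFn A ∧ ∃ Z : C₂.Φ.carrier A, Z ≠ 1 ∧ u.2 = Algebra.GrothendieckGroup.of Z)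
    (hZQ₂ : ∀ (W : D') (𝔭 : Primes (T'.Φ₀.obj (C₂.baseOp (op W)))),
      IsZMonoprime ↥𝔭.submonoid ∨ IsQMonoprime ↥𝔭.submonoid)
    (hsat₂ : ∀ (W : D'), ∀ x ∈ C₂.Φ.carrier (op W), ∃ (N : ℕ+) (d : T'.Φ₀.obj (C₂.baseOp (op W))),
      x ^ (N : ℕ) = T'.toR (C₂.baseOp (op W)) d)
    (hs₁ : IsFrobeniusSlim D) (hs₂ : IsFrobeniusSlim D') :
    Literature.AnabelianGeometry.EtaleTheta.PreservesBaseFieldTheoretic h :=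
  h.cor38_i_of_ratSupport hF₁ hF₂ hP34Λ₁ hNZ₁ hZQ₁ hsat₁ hP34Λ₂ hNZ₂ hZQ₂ hsat₂ hs₁ hs₂

end TreeMonoidVocab

/-! ## §2 Canonical vocabularies `treeMonoidVocab` / `treeCatVocab`: THE NODE from named structural clauses only -/

section Canonical

variable {D₀ : Type u₀} [Category.{v₀} D₀] {D₀' : Type u₀} [Category.{v₀} D₀']
  {T : RealifiedDivisorMonoids (D₀ := D₀) treeMonoidVocab.{w}}
  {T' : RealifiedDivisorMonoids (D₀ := D₀') treeMonoidVocab.{w}}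
  {D : Type u} [Category.{v} D] {D' : Type u} [Category.{v} D']
  {IsRational IsStrictlyRational : (Dᵒᵖ ⥤ CommMonCat.{w}) → Prop}
  {IsRational' IsStrictlyRational' : (D'ᵒᵖ ⥤ CommMonCat.{w}) → Prop}
  {C₁ : TemperedFrobenioid T D (treeCatVocab D IsRational IsStrictlyRational)}
  {C₂ : TemperedFrobenioid T' D' (treeCatVocab D' IsRational' IsStrictlyRational')} (h : Cor38Hyp C₁ C₂)
  {Dcnst : Type u₁} [Category.{v₁} Dcnst] {cnst : D₀ ⥤ Dcnst}
  {Dcnst' : Type u₁} [Category.{v₁} Dcnst'] {cnst' : D₀' ⥤ Dcnst'}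

/-- **F-2818 at the node's standing situation**: «`Ψ` preserves factorisations» for every Cor. 3.8 datum between tempered
Frobenioids over the canonical vocabularies, GIVEN ONLY `hBinj_i` (Def. 3.3 (iii): pull-backs of `B₀^Λ` injective) and
`hFSM_i` (FSM-morphisms of `D_i` are isomorphisms) — `hF_i` := abc-iut-L2-t3's `isFrobenioid_of_structural` ([FrdI] Thm.
5.2 (ii)). [cite: MochizukiEtTh2009, Cor 3.8 p.81] -/
theorem cor38_i_node_preservesFactorisation
    (hBinj₁ : ∀ {Y Y' : D₀ᵒᵖ} (g : Y ⟶ Y'), Injective (T.BΛ.map g).hom)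
    (hFSM₁ : ∀ {A B : D} (α : B ⟶ A), IsFSM α → IsIso α)
    (hBinj₂ : ∀ {Y Y' : D₀'ᵒᵖ} (g : Y ⟶ Y'), Injective (T'.BΛ.map g).hom)
    (hFSM₂ : ∀ {A B : D'} (α : B ⟶ A), IsFSM α → IsIso α) :
    Literature.AnabelianGeometry.EtaleTheta.Cor38Hyp.PreservesFactorisation h :=
  h.preservesFactorisation_of_isFrobenioid_treeMonoidVocab (C₁.isFrobenioid_of_structural hBinj₁ hFSM₁)
    (C₂.isFrobenioid_of_structural hBinj₂ hFSM₂)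

/-- **F-2816 at the node's standing situation**: «`Ψ` preserves the base-field-theoretic pre-steps» for Frobenius-slim
`D₁`, `D₂`, GIVEN per side `hBinj`, `hFSM`, `hP : T.Prop34Cnst cnst` (abc-iut-L2-t3's typed Prop. 3.4 (ii) structure; ⟹
`hP34Λ` by its field `mem_FΛ_of_divΛ_eq_of`), `hNZ`, `hZQ`, `hsat` — §1 `preservesBsFldPreSteps_of_ratSupport` with `hF_i` :=
`isFrobenioid_of_structural`. [cite: MochizukiEtTh2009, Cor 3.8 p.81] -/
theorem cor38_i_node_preservesBsFldPreSteps
    (hBinj₁ : ∀ {Y Y' : D₀ᵒᵖ} (g : Y ⟶ Y'), Injective (T.BΛ.map g).hom)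
    (hFSM₁ : ∀ {A B : D} (α : B ⟶ A), IsFSM α → IsIso α)
    (hP₁ : T.Prop34Cnst cnst)
    (hNZ₁ : ∀ A : Dᵒᵖ, ∃ u : (T.BΛ.obj (C₁.baseOp A) : Type w) × Algebra.GrothendieckGroup (C₁.Φ.carrier A),
      u ∈ C₁.cnstFn A ∧ ∃ Z : C₁.Φ.carrier A, Z ≠ 1 ∧ u.2 = Algebra.GrothendieckGroup.of Z)
    (hZQ₁ : ∀ (W : D) (𝔭 : Primes (T.Φ₀.obj (C₁.baseOp (op W)))),
      IsZMonoprime ↥𝔭.submonoid ∨ IsQMonoprime ↥𝔭.submonoid)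
    (hsat₁ : ∀ (W : D), ∀ x ∈ C₁.Φ.carrier (op W), ∃ (N : ℕ+) (d : T.Φ₀.obj (C₁.baseOp (op W))),
      x ^ (N : ℕ) = T.toR (C₁.baseOp (op W)) d)
    (hBinj₂ : ∀ {Y Y' : D₀'ᵒᵖ} (g : Y ⟶ Y'), Injective (T'.BΛ.map g).hom)
    (hFSM₂ : ∀ {A B : D'} (α : B ⟶ A), IsFSM α → IsIso α)
    (hP₂ : T'.Prop34Cnst cnst')
    (hNZ₂ : ∀ A : D'ᵒᵖ, ∃ u : (T'.BΛ.obj (C₂.baseOp A) : Type w) × Algebra.GrothendieckGroup (C₂.Φ.carrier A),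
      u ∈ C₂.cnstFn A ∧ ∃ Z : C₂.Φ.carrier A, Z ≠ 1 ∧ u.2 = Algebra.GrothendieckGroup.of Z)
    (hZQ₂ : ∀ (W : D') (𝔭 : Primes (T'.Φ₀.obj (C₂.baseOp (op W)))),
      IsZMonoprime ↥𝔭.submonoid ∨ IsQMonoprime ↥𝔭.submonoid)
    (hsat₂ : ∀ (W : D'), ∀ x ∈ C₂.Φ.carrier (op W), ∃ (N : ℕ+) (d : T'.Φ₀.obj (C₂.baseOp (op W))),
      x ^ (N : ℕ) = T'.toR (C₂.baseOp (op W)) d)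
    (hs₁ : IsFrobeniusSlim D) (hs₂ : IsFrobeniusSlim D') :
    Literature.AnabelianGeometry.EtaleTheta.Cor38Hyp.PreservesBsFldPreSteps h :=
  h.preservesBsFldPreSteps_of_ratSupport (C₁.isFrobenioid_of_structural hBinj₁ hFSM₁)
    (C₂.isFrobenioid_of_structural hBinj₂ hFSM₂) hP₁.mem_FΛ_of_divΛ_eq_of hNZ₁ hZQ₁ hsat₁ hP₂.mem_FΛ_of_divΛ_eq_of
    hNZ₂ hZQ₂ hsat₂ hs₁ hs₂

/-- **[EtTh] Cor. 3.8 (i) — THE NODE IN PRINT'S SHAPE from NAMED CLAUSES ONLY**: for tempered Frobenioids `C₁`, `C₂`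
over the canonical vocabularies and `h : Cor38Hyp C₁ C₂` ("`Ψ : C₁ ⥲ C₂`; `D_i` of FSMFF-type; `Φ_i` non-dilating"), GIVEN
per side {`hBinj`, `hFSM`, `hP : T.Prop34Cnst cnst`, `hNZ`, `hZQ`, `hsat`}: if `D₁`, `D₂` are Frobenius-slim then `Ψ` preserves
the base-field-theoretic morphisms — this lineage's `cor38_i_canonical_of_structural` (p438712) applied to `hs₁`, `hs₂`; the
proof rows C38-L06 / C38-L07 are the THEOREMS above, not binders. [cite: MochizukiEtTh2009, Cor 3.8 (i) p.80] -/
theorem cor38_i_node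
    (hBinj₁ : ∀ {Y Y' : D₀ᵒᵖ} (g : Y ⟶ Y'), Injective (T.BΛ.map g).hom)
    (hFSM₁ : ∀ {A B : D} (α : B ⟶ A), IsFSM α → IsIso α)
    (hP₁ : T.Prop34Cnst cnst)
    (hNZ₁ : ∀ A : Dᵒᵖ, ∃ u : (T.BΛ.obj (C₁.baseOp A) : Type w) × Algebra.GrothendieckGroup (C₁.Φ.carrier A),
      u ∈ C₁.cnstFn A ∧ ∃ Z : C₁.Φ.carrier A, Z ≠ 1 ∧ u.2 = Algebra.GrothendieckGroup.of Z)
    (hZQ₁ : ∀ (W : D) (𝔭 : Primes (T.Φ₀.obj (C₁.baseOp (op W)))),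
      IsZMonoprime ↥𝔭.submonoid ∨ IsQMonoprime ↥𝔭.submonoid)
    (hsat₁ : ∀ (W : D), ∀ x ∈ C₁.Φ.carrier (op W), ∃ (N : ℕ+) (d : T.Φ₀.obj (C₁.baseOp (op W))),
      x ^ (N : ℕ) = T.toR (C₁.baseOp (op W)) d)
    (hBinj₂ : ∀ {Y Y' : D₀'ᵒᵖ} (g : Y ⟶ Y'), Injective (T'.BΛ.map g).hom)
    (hFSM₂ : ∀ {A B : D'} (α : B ⟶ A), IsFSM α → IsIso α)
    (hP₂ : T'.Prop34Cnst cnst')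
    (hNZ₂ : ∀ A : D'ᵒᵖ, ∃ u : (T'.BΛ.obj (C₂.baseOp A) : Type w) × Algebra.GrothendieckGroup (C₂.Φ.carrier A),
      u ∈ C₂.cnstFn A ∧ ∃ Z : C₂.Φ.carrier A, Z ≠ 1 ∧ u.2 = Algebra.GrothendieckGroup.of Z)
    (hZQ₂ : ∀ (W : D') (𝔭 : Primes (T'.Φ₀.obj (C₂.baseOp (op W)))),
      IsZMonoprime ↥𝔭.submonoid ∨ IsQMonoprime ↥𝔭.submonoid)
    (hsat₂ : ∀ (W : D'), ∀ x ∈ C₂.Φ.carrier (op W), ∃ (N : ℕ+) (d : T'.Φ₀.obj (C₂.baseOp (op W))),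
      x ^ (N : ℕ) = T'.toR (C₂.baseOp (op W)) d)
    (hs₁ : IsFrobeniusSlim D) (hs₂ : IsFrobeniusSlim D') :
    Literature.AnabelianGeometry.EtaleTheta.PreservesBaseFieldTheoretic h :=
  h.cor38_i_canonical_of_structural hBinj₁ hFSM₁ hP₁ hNZ₁ hZQ₁ hsat₁ hBinj₂ hFSM₂ hP₂ hNZ₂ hZQ₂ hsat₂ hs₁ hs₂

/-- **[EtTh] Cor. 3.8 (i) AS TYPED at EVERY HONEST READING SLOT** of the free vocabulary parameter of abc-iut-L2-t3's
`Cor38_i` (p407532): for every predicate `S` on base categories implying L1's real [FrdI] Def. 3.1 (i) `IsFrobeniusSlim` at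
`D₁` and at `D₂` (reading slots `hS₁`, `hS₂`), the typed statement `Cor38_i S h` HOLDS given the named clauses; the canonical
slot `S := IsFrobeniusSlim` is `cor38_i_canonical_of_structural`.  (The ∀-closure over all data is FALSE —
`Cor38ToyPair.not_forall_cor38_i` — so the node IS its instance at honest slots and honest data.)
[cite: MochizukiEtTh2009, Cor 3.8 (i) p.80] -/
theorem cor38_i_node_of_slot (S : ∀ (E : Type u) [Category.{v} E], Prop)
    (hS₁ : S D → IsFrobeniusSlim D) (hS₂ : S D' → IsFrobeniusSlim D')
    (hBinj₁ : ∀ {Y Y' : D₀ᵒᵖ} (g : Y ⟶ Y'), Injective (T.BΛ.map g).hom)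
    (hFSM₁ : ∀ {A B : D} (α : B ⟶ A), IsFSM α → IsIso α)
    (hP₁ : T.Prop34Cnst cnst)
    (hNZ₁ : ∀ A : Dᵒᵖ, ∃ u : (T.BΛ.obj (C₁.baseOp A) : Type w) × Algebra.GrothendieckGroup (C₁.Φ.carrier A),
      u ∈ C₁.cnstFn A ∧ ∃ Z : C₁.Φ.carrier A, Z ≠ 1 ∧ u.2 = Algebra.GrothendieckGroup.of Z)
    (hZQ₁ : ∀ (W : D) (𝔭 : Primes (T.Φ₀.obj (C₁.baseOp (op W)))),
      IsZMonoprime ↥𝔭.submonoid ∨ IsQMonoprime ↥𝔭.submonoid)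
    (hsat₁ : ∀ (W : D), ∀ x ∈ C₁.Φ.carrier (op W), ∃ (N : ℕ+) (d : T.Φ₀.obj (C₁.baseOp (op W))),
      x ^ (N : ℕ) = T.toR (C₁.baseOp (op W)) d)
    (hBinj₂ : ∀ {Y Y' : D₀'ᵒᵖ} (g : Y ⟶ Y'), Injective (T'.BΛ.map g).hom)
    (hFSM₂ : ∀ {A B : D'} (α : B ⟶ A), IsFSM α → IsIso α)
    (hP₂ : T'.Prop34Cnst cnst')
    (hNZ₂ : ∀ A : D'ᵒᵖ, ∃ u : (T'.BΛ.obj (C₂.baseOp A) : Type w) × Algebra.GrothendieckGroup (C₂.Φ.carrier A),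
      u ∈ C₂.cnstFn A ∧ ∃ Z : C₂.Φ.carrier A, Z ≠ 1 ∧ u.2 = Algebra.GrothendieckGroup.of Z)
    (hZQ₂ : ∀ (W : D') (𝔭 : Primes (T'.Φ₀.obj (C₂.baseOp (op W)))),
      IsZMonoprime ↥𝔭.submonoid ∨ IsQMonoprime ↥𝔭.submonoid)
    (hsat₂ : ∀ (W : D'), ∀ x ∈ C₂.Φ.carrier (op W), ∃ (N : ℕ+) (d : T'.Φ₀.obj (C₂.baseOp (op W))),
      x ^ (N : ℕ) = T'.toR (C₂.baseOp (op W)) d) :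
    Literature.AnabelianGeometry.EtaleTheta.Cor38_i S h :=
  fun hs₁ hs₂ =>
    h.cor38_i_node hBinj₁ hFSM₁ hP₁ hNZ₁ hZQ₁ hsat₁ hBinj₂ hFSM₂ hP₂ hNZ₂ hZQ₂ hsat₂ (hS₁ hs₁) (hS₂ hs₂)

end Canonical

/-! ## §3 WEAK monoid vocabulary `treeMonoidVocabWeak` (the vocabulary of the models of record), ANY category vocabularies -/

section Weak

variable {D₀ : Type u₀} [Category.{v₀} D₀] {D₀' : Type u₀} [Category.{v₀} D₀']
  {D : Type u} [Category.{v} D] {D' : Type u} [Category.{v} D']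
  {VD : FrdICatStub.{u, v, w} D} {VD' : FrdICatStub.{u, v, w} D'}

/-- **C38-L07 = F-2818 from `hF₁`, `hF₂` ALONE over the WEAK monoid vocabulary** (p.81 l.15–18): abc-iut-L2-t3's reduction
`preservesFactorisation_of_thm34` fed with abc-iut-L2-d2's `preservesPreSteps_of_isFrobenioid_weak` (Thm. 3.4 (ii) AS
PRINTED), [FrdI] Thm. 3.4 (iii) := `FrdI.thm34iii_ofFunctor_of_thm34ii` over `FrdI.Thm34ii_holds`, and hypothesis (b)
vacuous by the binder-free weak row C38-L01 `standardIsotropicNotGroupLike_treeMonoidVocabWeak` — the abstract form of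
abc-iut-w6-d053's instance `cor38Hyp_preservesFactorisation_ofRankOnePoint`. [cite: MochizukiEtTh2009, Cor 3.8 p.81] -/
theorem preservesFactorisation_of_isFrobenioid_treeMonoidVocabWeak
    {T : RealifiedDivisorMonoids (D₀ := D₀) treeMonoidVocabWeak.{w}}
    {T' : RealifiedDivisorMonoids (D₀ := D₀') treeMonoidVocabWeak.{w}}
    {C₁ : TemperedFrobenioid T D VD} {C₂ : TemperedFrobenioid T' D' VD'} (h : Cor38Hyp C₁ C₂)
    (hF₁ : PreFrobenioid.IsFrobenioid C₁.toElem) (hF₂ : PreFrobenioid.IsFrobenioid C₂.toElem) :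
    Literature.AnabelianGeometry.EtaleTheta.Cor38Hyp.PreservesFactorisation h :=
  have H := h.standardIsotropicNotGroupLike_treeMonoidVocabWeak
  have h2 : C₁.opsData.Thm34ii C₂.opsData h.Ψ := FrdI.Thm34ii_holds _ _ hF₁ hF₂ h.Ψ
  have h2' : C₂.opsData.Thm34ii C₁.opsData h.Ψ.symm := FrdI.Thm34ii_holds _ _ hF₂ hF₁ h.Ψ.symm
  h.preservesFactorisation_of_thm34 (h.preservesPreSteps_of_isFrobenioid_weak hF₁ hF₂)
    (FrdI.thm34iii_ofFunctor_of_thm34ii hF₁ hF₂ h.Ψ h2 h2')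
    (FrdI.thm34iii_ofFunctor_of_thm34ii hF₂ hF₁ h.Ψ.symm h2' h2) H
    (h.hypB_of_standardIsotropicNotGroupLike H) (h.hypB_symm_of_standardIsotropicNotGroupLike H)

end Weak

/-! ## §4 WEAK monoid vocabulary at the canonical category vocabulary `treeCatVocab`: THE NODE from named clauses only -/

section WeakCanonical

variable {D₀ : Type u₀} [Category.{v₀} D₀] {D₀' : Type u₀} [Category.{v₀} D₀']
  {D : Type u} [Category.{v} D] {D' : Type u} [Category.{v} D']
  {IsRational IsStrictlyRational : (Dᵒᵖ ⥤ CommMonCat.{w}) → Prop}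
  {IsRational' IsStrictlyRational' : (D'ᵒᵖ ⥤ CommMonCat.{w}) → Prop}

/-- **F-2818 at the node's standing situation, weak monoid vocabulary**: «`Ψ` preserves factorisations» GIVEN ONLY
`hBinj_i`, `hFSM_i`. [cite: MochizukiEtTh2009, Cor 3.8 p.81] -/
theorem cor38_i_node_weak_preservesFactorisation
    {T : RealifiedDivisorMonoids (D₀ := D₀) treeMonoidVocabWeak.{w}}
    {T' : RealifiedDivisorMonoids (D₀ := D₀') treeMonoidVocabWeak.{w}}
    {C₁ : TemperedFrobenioid T D (treeCatVocab D IsRational IsStrictlyRational)}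
    {C₂ : TemperedFrobenioid T' D' (treeCatVocab D' IsRational' IsStrictlyRational')} (h : Cor38Hyp C₁ C₂)
    (hBinj₁ : ∀ {Y Y' : D₀ᵒᵖ} (g : Y ⟶ Y'), Injective (T.BΛ.map g).hom)
    (hFSM₁ : ∀ {A B : D} (α : B ⟶ A), IsFSM α → IsIso α)
    (hBinj₂ : ∀ {Y Y' : D₀'ᵒᵖ} (g : Y ⟶ Y'), Injective (T'.BΛ.map g).hom)
    (hFSM₂ : ∀ {A B : D'} (α : B ⟶ A), IsFSM α → IsIso α) :
    Literature.AnabelianGeometry.EtaleTheta.Cor38Hyp.PreservesFactorisation h :=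
  h.preservesFactorisation_of_isFrobenioid_treeMonoidVocabWeak (C₁.isFrobenioid_of_structural hBinj₁ hFSM₁)
    (C₂.isFrobenioid_of_structural hBinj₂ hFSM₂)

/-- **F-2816 at the node's standing situation, weak monoid vocabulary**, for Frobenius-slim `D₁`, `D₂`: this lineage's
vocabulary-generic `preservesBsFldPreSteps_of_thm34ii_of_criteria` (p439433; Thm. 3.4 (ii) := `FrdI.Thm34ii_holds`, Thm. 3.7
(ii) := the binder-free weak row C38-L01) with `hF_i` := `isFrobenioid_of_structural` and the criteria C38-L05 := abc-iut-L6-t12's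
`bsFldPreStepLimitCriterion_of_ratSupport_weak` (`hP34Λ_i` := `hP_i.mem_FΛ_of_divΛ_eq_of`). [cite: MochizukiEtTh2009, Cor 3.8 p.81] -/
theorem cor38_i_node_weak_preservesBsFldPreSteps
    {T : RealifiedDivisorMonoids (D₀ := D₀) treeMonoidVocabWeak.{w}}
    {T' : RealifiedDivisorMonoids (D₀ := D₀') treeMonoidVocabWeak.{w}}
    {C₁ : TemperedFrobenioid T D (treeCatVocab D IsRational IsStrictlyRational)}
    {C₂ : TemperedFrobenioid T' D' (treeCatVocab D' IsRational' IsStrictlyRational')} (h : Cor38Hyp C₁ C₂)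
    {Dcnst : Type u₁} [Category.{v₁} Dcnst] {cnst : D₀ ⥤ Dcnst}
    {Dcnst' : Type u₁} [Category.{v₁} Dcnst'] {cnst' : D₀' ⥤ Dcnst'}
    (hBinj₁ : ∀ {Y Y' : D₀ᵒᵖ} (g : Y ⟶ Y'), Injective (T.BΛ.map g).hom)
    (hFSM₁ : ∀ {A B : D} (α : B ⟶ A), IsFSM α → IsIso α)
    (hP₁ : T.Prop34Cnst cnst)
    (hNZ₁ : ∀ A : Dᵒᵖ, ∃ u : (T.BΛ.obj (C₁.baseOp A) : Type w) × Algebra.GrothendieckGroup (C₁.Φ.carrier A),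
      u ∈ C₁.cnstFn A ∧ ∃ Z : C₁.Φ.carrier A, Z ≠ 1 ∧ u.2 = Algebra.GrothendieckGroup.of Z)
    (hZQ₁ : ∀ (W : D) (𝔭 : Primes (T.Φ₀.obj (C₁.baseOp (op W)))),
      IsZMonoprime ↥𝔭.submonoid ∨ IsQMonoprime ↥𝔭.submonoid)
    (hsat₁ : ∀ (W : D), ∀ x ∈ C₁.Φ.carrier (op W), ∃ (N : ℕ+) (d : T.Φ₀.obj (C₁.baseOp (op W))),
      x ^ (N : ℕ) = T.toR (C₁.baseOp (op W)) d)
    (hBinj₂ : ∀ {Y Y' : D₀'ᵒᵖ} (g : Y ⟶ Y'), Injective (T'.BΛ.map g).hom)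
    (hFSM₂ : ∀ {A B : D'} (α : B ⟶ A), IsFSM α → IsIso α)
    (hP₂ : T'.Prop34Cnst cnst')
    (hNZ₂ : ∀ A : D'ᵒᵖ, ∃ u : (T'.BΛ.obj (C₂.baseOp A) : Type w) × Algebra.GrothendieckGroup (C₂.Φ.carrier A),
      u ∈ C₂.cnstFn A ∧ ∃ Z : C₂.Φ.carrier A, Z ≠ 1 ∧ u.2 = Algebra.GrothendieckGroup.of Z)
    (hZQ₂ : ∀ (W : D') (𝔭 : Primes (T'.Φ₀.obj (C₂.baseOp (op W)))),
      IsZMonoprime ↥𝔭.submonoid ∨ IsQMonoprime ↥𝔭.submonoid)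
    (hsat₂ : ∀ (W : D'), ∀ x ∈ C₂.Φ.carrier (op W), ∃ (N : ℕ+) (d : T'.Φ₀.obj (C₂.baseOp (op W))),
      x ^ (N : ℕ) = T'.toR (C₂.baseOp (op W)) d)
    (hs₁ : IsFrobeniusSlim D) (hs₂ : IsFrobeniusSlim D') :
    Literature.AnabelianGeometry.EtaleTheta.Cor38Hyp.PreservesBsFldPreSteps h :=
  have hF₁ := C₁.isFrobenioid_of_structural hBinj₁ hFSM₁
  have hF₂ := C₂.isFrobenioid_of_structural hBinj₂ hFSM₂
  h.preservesBsFldPreSteps_of_thm34ii_of_criteria FrdI.Thm34ii_holds hF₁ hF₂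
    h.standardIsotropicNotGroupLike_treeMonoidVocabWeak.standard.1
    h.standardIsotropicNotGroupLike_treeMonoidVocabWeak.standard.2
    (C₁.bsFldPreStepLimitCriterion_of_ratSupport_weak hF₁ hP₁.mem_FΛ_of_divΛ_eq_of hNZ₁ hZQ₁ hsat₁)
    (C₂.bsFldPreStepLimitCriterion_of_ratSupport_weak hF₂ hP₂.mem_FΛ_of_divΛ_eq_of hNZ₂ hZQ₂ hsat₂) hs₁ hs₂

/-- **[EtTh] Cor. 3.8 (i) — THE NODE IN PRINT'S SHAPE over the WEAK monoid vocabulary from NAMED CLAUSES ONLY** (per side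
{`hBinj`, `hFSM`, `hP : T.Prop34Cnst cnst`, `hNZ`, `hZQ`, `hsat`}): "`D₁`, `D₂` Frobenius-slim ⟹ `Ψ` preserves the
base-field-theoretic morphisms" — this lineage's `cor38_i_weak_of_ratSupport_of_structural` (p440385) applied to `hs₁`,
`hs₂`. [cite: MochizukiEtTh2009, Cor 3.8 (i) p.80] -/
theorem cor38_i_node_weak
    {T : RealifiedDivisorMonoids (D₀ := D₀) treeMonoidVocabWeak.{w}}
    {T' : RealifiedDivisorMonoids (D₀ := D₀') treeMonoidVocabWeak.{w}}
    {C₁ : TemperedFrobenioid T D (treeCatVocab D IsRational IsStrictlyRational)}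
    {C₂ : TemperedFrobenioid T' D' (treeCatVocab D' IsRational' IsStrictlyRational')} (h : Cor38Hyp C₁ C₂)
    {Dcnst : Type u₁} [Category.{v₁} Dcnst] {cnst : D₀ ⥤ Dcnst}
    {Dcnst' : Type u₁} [Category.{v₁} Dcnst'] {cnst' : D₀' ⥤ Dcnst'}
    (hBinj₁ : ∀ {Y Y' : D₀ᵒᵖ} (g : Y ⟶ Y'), Injective (T.BΛ.map g).hom)
    (hFSM₁ : ∀ {A B : D} (α : B ⟶ A), IsFSM α → IsIso α)
    (hP₁ : T.Prop34Cnst cnst)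
    (hNZ₁ : ∀ A : Dᵒᵖ, ∃ u : (T.BΛ.obj (C₁.baseOp A) : Type w) × Algebra.GrothendieckGroup (C₁.Φ.carrier A),
      u ∈ C₁.cnstFn A ∧ ∃ Z : C₁.Φ.carrier A, Z ≠ 1 ∧ u.2 = Algebra.GrothendieckGroup.of Z)
    (hZQ₁ : ∀ (W : D) (𝔭 : Primes (T.Φ₀.obj (C₁.baseOp (op W)))),
      IsZMonoprime ↥𝔭.submonoid ∨ IsQMonoprime ↥𝔭.submonoid)
    (hsat₁ : ∀ (W : D), ∀ x ∈ C₁.Φ.carrier (op W), ∃ (N : ℕ+) (d : T.Φ₀.obj (C₁.baseOp (op W))),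
      x ^ (N : ℕ) = T.toR (C₁.baseOp (op W)) d)
    (hBinj₂ : ∀ {Y Y' : D₀'ᵒᵖ} (g : Y ⟶ Y'), Injective (T'.BΛ.map g).hom)
    (hFSM₂ : ∀ {A B : D'} (α : B ⟶ A), IsFSM α → IsIso α)
    (hP₂ : T'.Prop34Cnst cnst')
    (hNZ₂ : ∀ A : D'ᵒᵖ, ∃ u : (T'.BΛ.obj (C₂.baseOp A) : Type w) × Algebra.GrothendieckGroup (C₂.Φ.carrier A),
      u ∈ C₂.cnstFn A ∧ ∃ Z : C₂.Φ.carrier A, Z ≠ 1 ∧ u.2 = Algebra.GrothendieckGroup.of Z)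
    (hZQ₂ : ∀ (W : D') (𝔭 : Primes (T'.Φ₀.obj (C₂.baseOp (op W)))),
      IsZMonoprime ↥𝔭.submonoid ∨ IsQMonoprime ↥𝔭.submonoid)
    (hsat₂ : ∀ (W : D'), ∀ x ∈ C₂.Φ.carrier (op W), ∃ (N : ℕ+) (d : T'.Φ₀.obj (C₂.baseOp (op W))),
      x ^ (N : ℕ) = T'.toR (C₂.baseOp (op W)) d)
    (hs₁ : IsFrobeniusSlim D) (hs₂ : IsFrobeniusSlim D') :
    Literature.AnabelianGeometry.EtaleTheta.PreservesBaseFieldTheoretic h :=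
  h.cor38_i_weak_of_ratSupport_of_structural hBinj₁ hFSM₁ hP₁ hNZ₁ hZQ₁ hsat₁ hBinj₂ hFSM₂ hP₂ hNZ₂ hZQ₂ hsat₂
    hs₁ hs₂

end WeakCanonical

end Cor38Hyp

end Literature.AnabelianGeometry.EtaleTheta
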